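import Summits.BirchSwinnertonDyer.BirchSwinnertonDyer.Theorems.DerivedKatoValuationDoorIntegralH1RankLeTwoOfAnalyticRankTwoCrisAtOfPoint
import Summits.BirchSwinnertonDyer.BirchSwinnertonDyer.Theorems.DerivedKatoValuationDoorIntegralH1RankLeTwoOfAnalyticRankTwoStubRankLeSelmerCorank
import Literature.NumberTheory.EllipticCurves.KuriharaNumber
import Literature.NumberTheory.EllipticCurves.KatoKolyvaginPrimes
import Literature.NumberTheory.EllipticCurves.CuspFormLFunction
import HarnessLib

/-!
# The (β) crux S2 `IntegralH1RankLeTwoOfAnalyticRankTwo` (stmt-BirchSwinnertonDyer-23752) from the registered stubs of line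
# `kurihara-two` of the sibling crux `SelmerRankRankTwo` (stmt-BirchSwinnertonDyer-0129), BY NAME — the Kurihara switch as a theorem
# (LEAD bsd-line-dkd-p1 g5, line `birth` r6; helper, closes nothing)

The strategist's second line on this crux (`Cruxes/IntegralH1RankLeTwoOfAnalyticRankTwo/Lines/kurihara.lean`, cstrat g0) re-types the
research stub N1∣_door («`a = 2 ⇒ s_p ≤ 2` at door primes») as KU ∧ A← in Kurihara coordinates, both VERBATIM the registered stubs of line
`kurihara-two` on stmt-0129:

* KU (`stub_kim_upper`, PRINT — Kim 2022 Thm. 1.9 (1)): a non-zero Kurihara number `δ_n^{(k)} = kuriharaNumber f (p^k) n ψ` of depth `ν(n)`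
  caps `corank_{ℤ_p} Sel_{p^∞}(W/ℚ) ≤ ν(n)` at a big-image good ordinary prime `p ≥ 5`;
* A← (`stub_exists_delta_of_rank_two`, OPEN — BSD-strength on its cell): `a = 2 ⇒` some Kurihara number of depth `≤ 2` is non-zero.

The lead keeps line `birth` registered on 23752 (PICKED.md: same open content, A← ≡ N1∣_door modulo Kim up/down; A← is staffed once, on
0129).  This file lands the switch itself where `lean search` finds it: §1 `selCapTwoAtDoor_of_kimUpper_of_existsDelta` — N1∣_door ⟸ KU ∧ A←
(the strategist's composition, re-proved here); §2 `integralH1RankLeTwoOfAnalyticRankTwo_of_kimUpper_of_existsDelta_of_crisAt` — **S2 ⟸ KU ∧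
A← ∧ ε** and `…_of_pointsTwo` — **S2 ⟸ KU ∧ A← ∧ `PointsTwo`**, otherwise print-free (dictionary-≤ = INPUTS' theorem
`stub_rankIntegralH1LeSelmerCorankAtDoor`, ε ⟸ a rational point of infinite order).  So a landing of A← on 0129 (even one conditional on Kim's
theorem) transports to this crux by name.  Nothing here proves KU, A←, N1∣_door, S2 or BSD.  Helper for stmt-BirchSwinnertonDyer-23752.

References: [cite: Kim2022StructureSelmer, Thm. 1.9 (1) (PDF p. 7), §8 (PDF p. 34)]; [cite: MazurRubin2004, Thm. 5.2.12];
[cite: PerrinRiou1993AIF, Lemme 2.3.9 (p. 967)]; [cite: BlochKato1990, Ex. 3.11].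
-/

set_option linter.dupNamespace false
set_option autoImplicit false

noncomputable section

open scoped MatrixGroups ModularForm Classical

namespace Summit.BirchSwinnertonDyer.BirchSwinnertonDyer.Theorems.DerivedKatoValuationDoor

open CongruenceSubgroup
open Literature Literature.NumberTheory.GaloisRepresentations
open Literature.NumberTheory.EllipticCurves Literature.NumberTheory.EllipticCurves.Kato2004
open Literature.NumberTheory.EllipticCurves.Kato2004.EulerSystemValues
open Literature.NumberTheory.EllipticCurves.ModularForms (IsNewformOf)
open Summit.BirchSwinnertonDyer.BirchSwinnertonDyer.Theses.DerivedKatoValuationDoor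
  (CrisAtDoorPrimes PointsTwo IntegralH1RankLeTwoOfAnalyticRankTwo)

/-! ## §1 N1∣_door from KU ∧ A← (the registered stubs of line `kurihara-two` on stmt-0129, as hypotheses verbatim) -/

/-- **N1∣_door ⟸ KU ∧ A←.**  At a door prime (`5 ≤ p`, `IsOrdinaryAt` = good ∧ `p ∤ a_p`, `ρ̄` onto) of a globally minimal analytic-rank-two
curve: A← gives `(f, k, n, ψ)` with `kuriharaNumber f (p^k) n ψ ≠ 0` and `ν(n) ≤ 2`; KU turns the non-vanishing into `s_p ≤ ν(n) ≤ 2`.  The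
hypotheses `hKU`, `hA` are the statements of the registered stubs `stub_kim_upper`, `stub_exists_delta_of_rank_two` of line `kurihara-two`
(stmt-BirchSwinnertonDyer-0129) verbatim; the conclusion is the registered research stub `stub_selCapTwoAtDoorOfAnalyticRankTwo` of line `birth`
(stmt-BirchSwinnertonDyer-23752) verbatim.  CONDITIONAL composition (both hypotheses unproved: KU print, A← open).
[cite: Kim2022StructureSelmer, Thm. 1.9 (1) (PDF p. 7)] -/
theorem selCapTwoAtDoor_of_kimUpper_of_existsDelta
    (hKU : ∀ (W : WeierstrassCurve ℚ) [W.IsElliptic] [W.IsGloballyMinimal] (p : ℕ) [Fact p.Prime],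
      5 ≤ p → W.HasGoodReductionAtPrime p → ¬ (p : ℤ) ∣ W.frobeniusTrace p →
      W.HasSurjectiveModNGaloisRep p →
      ∀ (_ : NeZero (W.conductorNorm ℤ)) (f : CuspForm (Gamma0 (W.conductorNorm ℤ)) 2),
        IsNewformOf W f →
        ∀ (k n : ℕ) [NeZero n], 1 ≤ k → Kato.IsKolyvaginProduct W p k n →
          ∀ ψ : (ℓ : ℕ) → (ZMod ℓ)ˣ →* Multiplicative (ZMod (p ^ k)),
            (∀ ℓ ∈ n.primeFactors, Function.Surjective (ψ ℓ)) →
            kuriharaNumber f (p ^ k) n ψ ≠ 0 → W.selmerCorank p ≤ n.primeFactors.card)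
    (hA : ∀ (W : WeierstrassCurve ℚ) [W.IsElliptic] [W.IsGloballyMinimal] (p : ℕ) [Fact p.Prime],
      5 ≤ p → W.HasGoodReductionAtPrime p → ¬ (p : ℤ) ∣ W.frobeniusTrace p →
      W.HasSurjectiveModNGaloisRep p → W.analyticRank = 2 →
      ∃ (_ : NeZero (W.conductorNorm ℤ)) (f : CuspForm (Gamma0 (W.conductorNorm ℤ)) 2),
        IsNewformOf W f ∧
        ∃ (k n : ℕ) (_ : NeZero n), 1 ≤ k ∧ Kato.IsKolyvaginProduct W p k n ∧
          n.primeFactors.card ≤ 2 ∧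
          ∃ ψ : (ℓ : ℕ) → (ZMod ℓ)ˣ →* Multiplicative (ZMod (p ^ k)),
            (∀ ℓ ∈ n.primeFactors, Function.Surjective (ψ ℓ)) ∧
            kuriharaNumber f (p ^ k) n ψ ≠ 0) :
    ∀ (W : WeierstrassCurve ℚ) [W.IsElliptic] [W.IsGloballyMinimal] (p : ℕ) [Fact p.Prime],
      W.analyticRank = 2 →
        (5 ≤ p ∧ Literature.NumberTheory.EllipticCurves.IsOrdinaryAt W p ∧ W.HasSurjectiveModNGaloisRep p) →
          W.selmerCorank p ≤ 2 := by
  intro W _ _ p _ ha hdoor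
  obtain ⟨h5, hord, hsurj⟩ := hdoor
  have hgood : W.HasGoodReductionAtPrime p := ((isOrdinaryAt_iff W p).1 hord).1
  have hap : ¬ (p : ℤ) ∣ W.frobeniusTrace p := ((isOrdinaryAt_iff W p).1 hord).2
  obtain ⟨hN, f, hf, k, n, hn0, hk, hn, hν, ψ, hψ, hδ⟩ := hA W p h5 hgood hap hsurj ha
  haveI : NeZero n := hn0
  exact (hKU W p h5 hgood hap hsurj hN f hf k n hk hn ψ hψ hδ).trans hν

/-! ## §2 S2 by name from KU ∧ A← ∧ ε (resp. `PointsTwo`) — otherwise print-free -/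

/-- **S2 ⟸ KU ∧ A← ∧ ε** (ε = the route item `CrisAtDoorPrimes`, stmt-BirchSwinnertonDyer-23148): KU ∧ A← give N1∣_door (§1), ε feeds
INPUTS' dictionary-≤ THEOREM `stub_rankIntegralH1LeSelmerCorankAtDoor` (`rank_{ℤ_p} H¹(ℤ[1/p], T_pW) ≤ s_p` at a door prime), and `s_p ≤ 2`
finishes.  No named fact beyond the three hypotheses. [cite: Kim2022StructureSelmer, Thm. 1.9 (1) (PDF p. 7)]
[cite: PerrinRiou1993AIF, Lemme 2.3.9 (p. 967)] -/
theorem integralH1RankLeTwoOfAnalyticRankTwo_of_kimUpper_of_existsDelta_of_crisAt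
    (hKU : ∀ (W : WeierstrassCurve ℚ) [W.IsElliptic] [W.IsGloballyMinimal] (p : ℕ) [Fact p.Prime],
      5 ≤ p → W.HasGoodReductionAtPrime p → ¬ (p : ℤ) ∣ W.frobeniusTrace p →
      W.HasSurjectiveModNGaloisRep p →
      ∀ (_ : NeZero (W.conductorNorm ℤ)) (f : CuspForm (Gamma0 (W.conductorNorm ℤ)) 2),
        IsNewformOf W f →
        ∀ (k n : ℕ) [NeZero n], 1 ≤ k → Kato.IsKolyvaginProduct W p k n →
          ∀ ψ : (ℓ : ℕ) → (ZMod ℓ)ˣ →* Multiplicative (ZMod (p ^ k)),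
            (∀ ℓ ∈ n.primeFactors, Function.Surjective (ψ ℓ)) →
            kuriharaNumber f (p ^ k) n ψ ≠ 0 → W.selmerCorank p ≤ n.primeFactors.card)
    (hA : ∀ (W : WeierstrassCurve ℚ) [W.IsElliptic] [W.IsGloballyMinimal] (p : ℕ) [Fact p.Prime],
      5 ≤ p → W.HasGoodReductionAtPrime p → ¬ (p : ℤ) ∣ W.frobeniusTrace p →
      W.HasSurjectiveModNGaloisRep p → W.analyticRank = 2 →
      ∃ (_ : NeZero (W.conductorNorm ℤ)) (f : CuspForm (Gamma0 (W.conductorNorm ℤ)) 2),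
        IsNewformOf W f ∧
        ∃ (k n : ℕ) (_ : NeZero n), 1 ≤ k ∧ Kato.IsKolyvaginProduct W p k n ∧
          n.primeFactors.card ≤ 2 ∧
          ∃ ψ : (ℓ : ℕ) → (ZMod ℓ)ˣ →* Multiplicative (ZMod (p ^ k)),
            (∀ ℓ ∈ n.primeFactors, Function.Surjective (ψ ℓ)) ∧
            kuriharaNumber f (p ^ k) n ψ ≠ 0)
    (hCris : CrisAtDoorPrimes) : IntegralH1RankLeTwoOfAnalyticRankTwo := by
  intro W _ _ p _ _ ha hdoor
  have hSel : W.selmerCorank p ≤ 2 := selCapTwoAtDoor_of_kimUpper_of_existsDelta hKU hA W p ha hdoor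
  have h1 : Module.rank ℤ_[p] ↥(integralH1 (tateRep W p) p ⊤) ≤ (W.selmerCorank p : Cardinal) :=
    stub_rankIntegralH1LeSelmerCorankAtDoor W p hdoor (hCris W p ha hdoor)
  have h2 : (W.selmerCorank p : Cardinal) ≤ 2 := by exact_mod_cast hSel
  exact h1.trans h2

/-- **S2 ⟸ KU ∧ A← ∧ `PointsTwo`** (stmt-BirchSwinnertonDyer-23026, the route's residual; ε from one rational point of infinite order,
`crisAtDoorPrimes_of_pointsTwo`).  Inside route DerivedKatoValuationDoor, whose `closes` binds `PointsTwo`, a landing of the two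
`kurihara-two` stubs of stmt-0129 therefore yields the deciding crux by name. [cite: Kim2022StructureSelmer, Thm. 1.9 (1) (PDF p. 7)]
[cite: BlochKato1990, Ex. 3.11] -/
theorem integralH1RankLeTwoOfAnalyticRankTwo_of_kimUpper_of_existsDelta_of_pointsTwo
    (hKU : ∀ (W : WeierstrassCurve ℚ) [W.IsElliptic] [W.IsGloballyMinimal] (p : ℕ) [Fact p.Prime],
      5 ≤ p → W.HasGoodReductionAtPrime p → ¬ (p : ℤ) ∣ W.frobeniusTrace p →
      W.HasSurjectiveModNGaloisRep p →
      ∀ (_ : NeZero (W.conductorNorm ℤ)) (f : CuspForm (Gamma0 (W.conductorNorm ℤ)) 2),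
        IsNewformOf W f →
        ∀ (k n : ℕ) [NeZero n], 1 ≤ k → Kato.IsKolyvaginProduct W p k n →
          ∀ ψ : (ℓ : ℕ) → (ZMod ℓ)ˣ →* Multiplicative (ZMod (p ^ k)),
            (∀ ℓ ∈ n.primeFactors, Function.Surjective (ψ ℓ)) →
            kuriharaNumber f (p ^ k) n ψ ≠ 0 → W.selmerCorank p ≤ n.primeFactors.card)
    (hA : ∀ (W : WeierstrassCurve ℚ) [W.IsElliptic] [W.IsGloballyMinimal] (p : ℕ) [Fact p.Prime],
      5 ≤ p → W.HasGoodReductionAtPrime p → ¬ (p : ℤ) ∣ W.frobeniusTrace p →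
      W.HasSurjectiveModNGaloisRep p → W.analyticRank = 2 →
      ∃ (_ : NeZero (W.conductorNorm ℤ)) (f : CuspForm (Gamma0 (W.conductorNorm ℤ)) 2),
        IsNewformOf W f ∧
        ∃ (k n : ℕ) (_ : NeZero n), 1 ≤ k ∧ Kato.IsKolyvaginProduct W p k n ∧
          n.primeFactors.card ≤ 2 ∧
          ∃ ψ : (ℓ : ℕ) → (ZMod ℓ)ˣ →* Multiplicative (ZMod (p ^ k)),
            (∀ ℓ ∈ n.primeFactors, Function.Surjective (ψ ℓ)) ∧
            kuriharaNumber f (p ^ k) n ψ ≠ 0)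
    (hPts : PointsTwo) : IntegralH1RankLeTwoOfAnalyticRankTwo :=
  integralH1RankLeTwoOfAnalyticRankTwo_of_kimUpper_of_existsDelta_of_crisAt hKU hA (crisAtDoorPrimes_of_pointsTwo hPts)

end Summit.BirchSwinnertonDyer.BirchSwinnertonDyer.Theorems.DerivedKatoValuationDoor

end
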